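import Mathlib.CategoryTheory.SingleObj
import Literature.IUT.HodgeTheaters.FPrimeStrips

/-!
# [IUTchI] §6: the ΘNF-side inputs of Definition 6.13 as a hypothesis kit (TODO-merge:abc-iut-L5-t3)

Mochizuki, *Inter-universal Teichmüller theory I*, §6, Remark 6.12.2 and Definition 6.13 pp. 174–175,
182–183 glue a Θ^{±ell}-Hodge theater to a ΘNF-Hodge theater ([IUTchI] Def 5.5 (iii), p. 153) along
the associated Θ^±- and Θ-bridges. The ΘNF-Hodge theaters, Θ-bridges (Def 5.5 (ii)) and the base notions
`𝒟`-ΘNF-Hodge theater (Def 4.6 (iii)) they rest on are typed by abc-iut-L5-t3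
(`Literature/IUT/HodgeTheaters/ThetaNFHodgeTheaters.lean`, `BaseHodgeTheaters.lean`; staged in the
cell's HOME). Until those modules are landed and built, this file provides — per the layer's stub rule —
ONE hypothesis structure `PMBaseKit.S5Local` whose fields quote the printed objects that Rmk 6.12.2 and
Def 6.13 consume, each marked `TODO-merge:abc-iut-L5-t3 <item>`; no node of §5 is claimed here
([IUTchI] Def 5.5 p. 151) [claim: Mochizuki2012, status: disputed].
-/

namespace Literature.IUT.HodgeTheaters

open CategoryTheory

universe u

namespace PMBaseKit

variable {l : ℕ} (K : PMBaseKit.{u} l)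

/-- TODO-merge:abc-iut-L5-t3 Def 5.5 (ii), (iii); Def 4.6 (iii). **Hypothesis kit for the ΘNF side**:
the type of ΘNF-Hodge theaters `‡ℋ𝒯^{ΘNF} = (‡ℱ^⊛ ⇠ ‡ℱ^⊚ ← ‡𝔉_J → ‡𝔉_> ⇢ ‡ℋ𝒯^Θ)` ([IUTchI] Def 5.5 (iii)
p. 153) with the data of its Θ-bridge "(a) `‡𝔉_J = {‡𝔉_j}_{j∈J}` … a capsule of `ℱ`-prime-strips, indexed
by a finite index set `J`; … (c) `‡𝔉_>` … the `ℱ`-prime-strip tautologically associated to `‡ℋ𝒯^Θ`; (d)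
… poly-morphisms … determined … by a `𝒟-Θ`-bridge `‡φ^Θ_⋇ = {‡φ^Θ_j : ‡𝔇_j → ‡𝔇_>}_{j∈J}`" (Def 5.5 (ii)
pp. 152–153), the global base objects `†𝒟^⊚` with their views at each `v`, and the predicate "forms a
`𝒟-ΘNF`-Hodge theater" (Def 4.6 (iii) p. 112). ([IUTchI] Def 5.5 (iii) p.153) [claim: Mochizuki2012, status: disputed] -/
structure S5Local (M : K.MultKit) (FK : K.FKit M) where
  /-- TODO-merge:abc-iut-L5-t3 Def 4.1 (v): the ambient category of global base objects `†𝒟^⊚`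
  (isomorphs of `𝒟^⊚ = ℬ(C_K)⁰`) -/
  CatAmb : Type u
  /-- category structure -/
  [catAmb : Category.{u} CatAmb]
  /-- TODO-merge:abc-iut-L5-t3 Example 4.3 (ii), (iii): a global object seen at `v`, so that the
  constituents `†𝒟_{v_j} → †𝒟^⊚` of a `𝒟`-NF-bridge are morphisms of `Amb v` -/
  nfAtV : ∀ v, CatAmb ⥤ K.Amb v
  /-- TODO-merge:abc-iut-L5-t3 Def 4.6 (iii): "`†φ^{NF}_⋇` is a `𝒟`-NF-bridge; `†φ^Θ_⋇` is a `𝒟-Θ`-bridge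
  — such that there exist isomorphisms `𝒟^⊚ ⥲ †𝒟^⊚`; `𝔇_⋇ ⥲ †𝔇_J`; `𝔇_> ⥲ †𝔇_>` conjugation by which maps
  `φ^{NF}_⋇ ↦ †φ^{NF}_⋇`, `φ^Θ_⋇ ↦ †φ^Θ_⋇`", as a predicate on (`𝒟-Θ`-bridge data, global object, NF
  poly-morphisms) -/
  IsDThetaNFHT : ∀ (B : K.DThetaBridgeData) (G : CatAmb),
    (∀ j v, Set ((B.capsule j).obj v ⟶ (nfAtV v).obj G)) → Prop
  /-- TODO-merge:abc-iut-L5-t3 Def 5.5 (iii): the type of ΘNF-Hodge theaters -/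
  ThetaNFHT : Type u
  /-- TODO-merge:abc-iut-L5-t3 Def 5.5 (ii) (a): the finite index set `J` of the capsule of the
  Θ-bridge of a ΘNF-Hodge theater -/
  thJ : ThetaNFHT → Type
  /-- TODO-merge:abc-iut-L5-t3 Def 5.5 (ii) (a): the capsule `‡𝔉_J` of `ℱ`-prime-strips -/
  thCapsule : ∀ H, thJ H → FK.FStrip
  /-- TODO-merge:abc-iut-L5-t3 Def 5.5 (ii) (c): `‡𝔉_>`, the `ℱ`-prime-strip tautologically associated
  to the Θ-Hodge theater `‡ℋ𝒯^Θ` -/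
  thFgt : ThetaNFHT → FK.FStrip
  /-- TODO-merge:abc-iut-L5-t3 Def 5.5 (ii) (d): the constituents `‡φ^Θ_{v_j} : ‡𝒟_{v_j} → ‡𝒟_{>,v}` of the
  underlying `𝒟-Θ`-bridge -/
  thDPoly : ∀ H (j : thJ H) v, Set (((thCapsule H j).assocD).obj v ⟶ (thFgt H).assocD.obj v)

attribute [instance] S5Local.catAmb

namespace S5Local

variable {K} {M : K.MultKit} {FK : K.FKit M} (N : K.S5Local M FK)

/-- The `𝒟-Θ`-bridge data `(‡𝔇_J → ‡𝔇_>)` underlying a ΘNF-Hodge theater ([IUTchI] Def 5.5 (ii) p. 153: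
"any Θ-bridge as above determines an associated `𝒟-Θ`-bridge"; TODO-merge:abc-iut-L5-t3).
([IUTchI] Def 5.5 (ii) p.153) [claim: Mochizuki2012, status: disputed] -/
noncomputable def thetaBridgeData (H : N.ThetaNFHT) : K.DThetaBridgeData :=
  ⟨ULift (N.thJ H), fun j => (N.thCapsule H j.down).assocD, (N.thFgt H).assocD,
    fun j v => N.thDPoly H j.down v⟩

end S5Local

/-! ### Consistency: a model of `S5Local` over the toy kits -/

/-- A model of the ΘNF-side kit over `FKit.toy` (prime `l ≠ 2`): global objects = the one-object
category of the toy base kit seen at `v` through its functor, one ΘNF-Hodge theater with empty capsule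
— witnessing that `S5Local` has honest inhabitants ([IUTchI] Def 5.5 (iii) p. 153).
([IUTchI] Def 5.5 (iii) p.153) [claim: Mochizuki2012, status: disputed] -/
noncomputable def S5Local.toy (l : ℕ) [Fact l.Prime] (hl : l ≠ 2) : (toyKit l hl).S5Local (MultKit.toy l hl) (FKit.toy l hl) where
  CatAmb := SingleObj (Model.AGL l)
  nfAtV _ := Model.atV' l
  IsDThetaNFHT _ _ _ := True
  ThetaNFHT := PUnit
  thJ _ := PEmpty
  thCapsule _ j := j.elim
  thFgt _ := ⟨fun _ => Model.Obj.loc, fun _ => ⟨Iso.refl _⟩⟩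
  thDPoly _ j := j.elim

end PMBaseKit

end Literature.IUT.HodgeTheaters
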